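import Mathlib
import HarnessLib

/-!
# Crux `PriceOfContractivity` (stmt-ValiantsHypothesis-10583), line `birth` — stub
# `stub_cycleBound`: the cycle-mean bound from balancing and the arc bound

Route `ValiantsHypothesis/ContractivityPrice`, crux K1
(`Summit.ValiantsHypothesis.ValiantsHypothesis.Theses.ContractivityPrice.PriceOfContractivity`).
This file proves the registered stub `stub_cycleBound` of the lead's skeleton (line `birth`,
rev 4): the REDUCTION of Theorem 4 ("max cycle geometric mean `≤ 240 R³ ×` principal-minor
radius") to Lemma 1 (max-plus balancing by a positive diagonal similarity) and Lemma 2 (the arc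
bound for matrices with unit superdiagonal and tiny interval minors), both taken as hypotheses
verbatim.

Proof.  Let `γ` be the maximum over all cycles `u : Fin (k+1) ↪ Fin R` of the geometric mean
`‖∏ t, K (u t) (u (t+1))‖ ^ (1/(k+1))`; every cycle product is then `≤ γ ^ length`, so it suffices
to show `γ ≤ 240 R³ ν`.  If `γ = 0` there is nothing to do; if the maximum is attained on a loop,
`γ = ‖K i i‖ ≤ ν`.  Otherwise it is attained on a cycle `u` of length `k + 1 ≥ 2`; balancing at
level `γ` gives positive weights `d` with `d i ‖K i j‖ / d j ≤ γ`, and along `u` the balanced,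
normalised edge weights have modulus `≤ 1` and product `≥ 1`, hence modulus exactly `1`.
Conjugating the restriction of the balanced matrix to the cycle (in cyclic order) by the diagonal
unitary of partial edge products produces `B` with unit superdiagonal, entries of modulus `≤ 1`,
interval minors `≤ (ν/γ)^{size}` (they are rescaled principal minors of `K`) and closing edge
`‖B k 0‖ = 1`; if `ν/γ ≤ 1/(240 (k+1)³)` the arc bound would give `‖B k 0‖ ≤ (16(k+1))^k (ν/γ)^{k+1}
< 1`, a contradiction.  Hence `γ < 240 (k+1)³ ν ≤ 240 R³ ν`.
-/

noncomputable section

-- single-conjunct layout: Sub = Summit, duplicated namespace component intended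
set_option linter.dupNamespace false

namespace Summit.ValiantsHypothesis.ValiantsHypothesis.Theorems.PriceOfContractivity.CycleBound

open Matrix Finset

/-! ### Two elementary lemmas -/

/-- Two-sided diagonal scaling of a matrix scales the determinant by the products of the scaling
factors: `det (α i * M i j * β j) = (∏ α) * (∏ β) * det M`. [folklore] -/
theorem det_of_mul_mul {n : Type*} [Fintype n] [DecidableEq n] {S : Type*} [CommRing S]
    (α β : n → S) (M : Matrix n n S) :
    (Matrix.of fun i j => α i * M i j * β j).det = (∏ i, α i) * (∏ j, β j) * M.det := by
  have h1 : (Matrix.of fun i j => α i * M i j * β j) =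
      Matrix.of fun i j => α i * (Matrix.of fun i' j' => β j' * M i' j') i j := by
    ext i j
    simp only [Matrix.of_apply]
    ring
  rw [h1, Matrix.det_mul_column, Matrix.det_mul_row]
  ring

/-- If finitely many reals in `[0, 1]` have product `≥ 1`, each of them equals `1`. [folklore] -/
theorem eq_one_of_one_le_prod {ι : Type*} [Fintype ι] [DecidableEq ι] (f : ι → ℝ)
    (h0 : ∀ i, 0 ≤ f i) (h1 : ∀ i, f i ≤ 1) (hp : 1 ≤ ∏ i, f i) (i : ι) : f i = 1 := by
  refine le_antisymm (h1 i) ?_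
  have hrest : ∏ j ∈ Finset.univ.erase i, f j ≤ 1 :=
    Finset.prod_le_one (fun j _ => h0 j) (fun j _ => h1 j)
  calc (1 : ℝ) ≤ ∏ j, f j := hp
    _ = f i * ∏ j ∈ Finset.univ.erase i, f j := (Finset.mul_prod_erase _ _ (Finset.mem_univ i)).symm
    _ ≤ f i * 1 := mul_le_mul_of_nonneg_left hrest (h0 i)
    _ = f i := mul_one _

/-! ### The reduction on a critical cycle of length at least two -/

/-- **Core of the reduction.** Let `d` be positive weights with `d i ‖K i j‖ / d j ≤ γ` (`γ > 0`),
let all principal minors of `K` be `≤ ν^{size}`, and let `u` be a cycle of length `k + 1 ≥ 2` with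
cycle product of modulus `≥ γ^{k+1}`.  Then the arc bound (hypothesis `harc`, Lemma 2) forces
`γ ≤ 240 (k+1)³ ν`: the balanced, normalised, phase-conjugated restriction of `K` to the cycle has
unit superdiagonal, entries of modulus `≤ 1`, interval minors `≤ (ν/γ)^{size}` and a closing edge
of modulus `1`, which the arc bound makes `< 1` as soon as `ν/γ ≤ 1/(240 (k+1)³)`. [folklore] -/
theorem core_cycle
    (harc : ∀ (n : ℕ) (B : Matrix (Fin n) (Fin n) ℂ) (δ : ℝ), 2 ≤ n → 0 ≤ δ →
      δ ≤ 1 / (240 * (n : ℝ) ^ 3) →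
      (∀ (t : ℕ) (h : t + 1 < n), B ⟨t, by omega⟩ ⟨t + 1, h⟩ = 1) →
      (∀ i j : Fin n, ‖B i j‖ ≤ 1) →
      (∀ (a k : ℕ) (h : a + k < n),
        ‖(B.submatrix (fun i : Fin (k + 1) => (⟨a + i.val, by omega⟩ : Fin n))
          (fun i : Fin (k + 1) => (⟨a + i.val, by omega⟩ : Fin n))).det‖ ≤ δ ^ (k + 1)) →
      ∀ (a k : ℕ) (h : a + k < n), ‖B ⟨a + k, h⟩ ⟨a, by omega⟩‖ ≤ (16 * (n : ℝ)) ^ k * δ ^ (k + 1))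
    {R : ℕ} (K : Matrix (Fin R) (Fin R) ℂ) {ν γ : ℝ} (hν : 0 ≤ ν) (hγ : 0 < γ)
    (hmin : ∀ (k : ℕ) (w : Fin (k + 1) → Fin R), Function.Injective w →
      ‖(K.submatrix w w).det‖ ≤ ν ^ (k + 1))
    (d : Fin R → ℝ) (hd : ∀ i, 0 < d i) (hdK : ∀ i j, d i * ‖K i j‖ / d j ≤ γ)
    {k : ℕ} (hk : 1 ≤ k) (u : Fin (k + 1) → Fin R) (hu : Function.Injective u)
    (hP : γ ^ (k + 1) ≤ ‖∏ t, K (u t) (u (t + 1))‖) :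
    γ ≤ 240 * ((k : ℝ) + 1) ^ 3 * ν := by
  -- the balanced, normalised matrix `e = D K D⁻¹ / γ`
  set e : Matrix (Fin R) (Fin R) ℂ :=
    fun i j => (d i : ℂ) * K i j * ((d j : ℂ))⁻¹ * ((γ : ℂ))⁻¹ with he_def
  have he_norm : ∀ i j, ‖e i j‖ = ‖K i j‖ * (d i / d j) * γ⁻¹ := by
    intro i j
    simp only [he_def, norm_mul, norm_inv, Complex.norm_real, Real.norm_eq_abs,
      abs_of_pos (hd _), abs_of_pos hγ]
    ring
  have he_le : ∀ i j, ‖e i j‖ ≤ 1 := by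
    intro i j
    have h1 : ‖K i j‖ * (d i / d j) * γ⁻¹ = (d i * ‖K i j‖ / d j) / γ := by ring
    rw [he_norm, h1, div_le_one hγ]
    exact hdK i j
  -- the cycle edges have modulus exactly one
  set c : Fin (k + 1) → ℂ := fun t => e (u t) (u (t + 1)) with hc_def
  have hc_le : ∀ t, ‖c t‖ ≤ 1 := fun t => he_le _ _
  have hshift : ∏ t : Fin (k + 1), d (u (t + 1)) = ∏ t, d (u t) :=
    Fintype.prod_equiv (Equiv.addRight 1) _ _ (fun t => rfl)
  have hdprod : 0 < ∏ t : Fin (k + 1), d (u t) := Finset.prod_pos (fun t _ => hd _)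
  have hprod : ∏ t, ‖c t‖ = ‖∏ t, K (u t) (u (t + 1))‖ * (γ ^ (k + 1))⁻¹ := by
    have h1 : ∏ t, ‖c t‖ =
        (∏ t, ‖K (u t) (u (t + 1))‖) * ((∏ t, d (u t)) / (∏ t : Fin (k + 1), d (u (t + 1)))) *
          ∏ _t : Fin (k + 1), γ⁻¹ := by
      rw [← Finset.prod_div_distrib, ← Finset.prod_mul_distrib, ← Finset.prod_mul_distrib]
      exact Finset.prod_congr rfl (fun t _ => by rw [hc_def, he_norm])
    rw [h1, hshift, div_self hdprod.ne', mul_one, Finset.prod_const, Finset.card_univ,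
      Fintype.card_fin, norm_prod, inv_pow]
  have hone : 1 ≤ ∏ t, ‖c t‖ := by
    rw [hprod, ← div_eq_mul_inv, one_le_div (pow_pos hγ _)]
    exact hP
  have hc1 : ∀ t, ‖c t‖ = 1 :=
    eq_one_of_one_le_prod (fun t => ‖c t‖) (fun t => norm_nonneg _) hc_le hone
  -- phases: partial products of the edge weights
  set c' : ℕ → ℂ := fun t => if h : t < k + 1 then c ⟨t, h⟩ else 1 with hc'_def
  have hc'1 : ∀ t, ‖c' t‖ = 1 := by
    intro t
    simp only [hc'_def]
    split_ifs
    · exact hc1 _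
    · exact norm_one
  set ph : ℕ → ℂ := fun t => ∏ s ∈ Finset.range t, c' s with hph_def
  have hph1 : ∀ t, ‖ph t‖ = 1 := by
    intro t
    simp only [hph_def, norm_prod, hc'1, Finset.prod_const_one]
  have hph_ne : ∀ t, ph t ≠ 0 := fun t => by
    rw [← norm_ne_zero_iff, hph1]; exact one_ne_zero
  have hph_succ : ∀ t, ph (t + 1) = ph t * c' t := fun t => Finset.prod_range_succ _ _
  -- the conjugated restriction to the cycle
  set B : Matrix (Fin (k + 1)) (Fin (k + 1)) ℂ :=
    Matrix.of fun t s => ph t.val * e (u t) (u s) * (ph s.val)⁻¹ with hB_def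
  have hBnorm : ∀ t s, ‖B t s‖ = ‖e (u t) (u s)‖ := by
    intro t s
    simp only [hB_def, Matrix.of_apply, norm_mul, norm_inv, hph1]
    ring
  have hA2 : ∀ i j : Fin (k + 1), ‖B i j‖ ≤ 1 := fun i j => (hBnorm i j).le.trans (he_le _ _)
  have hA1 : ∀ (t : ℕ) (h : t + 1 < k + 1), B ⟨t, by omega⟩ ⟨t + 1, h⟩ = 1 := by
    intro t h
    have hsucc : (⟨t, by omega⟩ : Fin (k + 1)) + 1 = ⟨t + 1, h⟩ := by
      apply Fin.ext
      rw [Fin.val_add_one_of_lt (by rw [Fin.lt_def]; exact (show t < k by omega))]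
    have hct : c' t = e (u ⟨t, by omega⟩) (u ⟨t + 1, h⟩) := by
      simp only [hc'_def, dif_pos (show t < k + 1 by omega), hc_def, hsucc]
    have hne : ph t * c' t ≠ 0 := by rw [← hph_succ]; exact hph_ne _
    simp only [hB_def, Matrix.of_apply]
    rw [← hct, hph_succ, mul_inv_cancel₀ hne]
  have hA3 : ∀ (a j : ℕ) (h : a + j < k + 1),
      ‖(B.submatrix (fun i : Fin (j + 1) => (⟨a + i.val, by omega⟩ : Fin (k + 1)))
        (fun i : Fin (j + 1) => (⟨a + i.val, by omega⟩ : Fin (k + 1)))).det‖ ≤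
        (ν / γ) ^ (j + 1) := by
    intro a j h
    set f : Fin (j + 1) → Fin (k + 1) := fun i => ⟨a + i.val, by omega⟩ with hf_def
    have hf : Function.Injective f := by
      intro i i' hii'
      simp only [hf_def, Fin.mk.injEq] at hii'
      exact Fin.ext (by omega)
    have hw : Function.Injective (u ∘ f) := hu.comp hf
    have hsub : B.submatrix f f = Matrix.of fun i i' =>
        (ph (f i).val * (d (u (f i)) : ℂ)) * (K.submatrix (u ∘ f) (u ∘ f)) i i' *
          (((d (u (f i')) : ℂ))⁻¹ * ((γ : ℂ))⁻¹ * (ph (f i').val)⁻¹) := by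
      ext i i'
      simp only [Matrix.submatrix_apply, hB_def, Matrix.of_apply, he_def, Function.comp_apply]
      ring
    have hfac : ∀ i : Fin (j + 1), ‖ph (f i).val * (d (u (f i)) : ℂ)‖ *
        ‖((d (u (f i)) : ℂ))⁻¹ * ((γ : ℂ))⁻¹ * (ph (f i).val)⁻¹‖ = γ⁻¹ := by
      intro i
      have hdi : d (u (f i)) ≠ 0 := (hd _).ne'
      simp only [norm_mul, norm_inv, hph1, Complex.norm_real, Real.norm_eq_abs,
        abs_of_pos (hd _), abs_of_pos hγ]
      field_simp
    rw [hsub, det_of_mul_mul, norm_mul, norm_mul, norm_prod, norm_prod, ← Finset.prod_mul_distrib,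
      Finset.prod_congr rfl (fun i _ => hfac i), Finset.prod_const, Finset.card_univ,
      Fintype.card_fin, div_pow, div_eq_inv_mul, ← inv_pow]
    exact mul_le_mul_of_nonneg_left (hmin j (u ∘ f) hw) (by positivity)
  -- the closing edge has modulus one
  have hlast : ‖B ⟨0 + k, by omega⟩ ⟨0, by omega⟩‖ = 1 := by
    rw [hBnorm]
    have hwrap : (⟨0 + k, by omega⟩ : Fin (k + 1)) + 1 = ⟨0, by omega⟩ := by
      apply Fin.ext
      simp [Fin.val_add]
    have h1 := hc1 ⟨0 + k, by omega⟩
    simp only [hc_def, hwrap] at h1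
    exact h1
  -- if `ν / γ` were small, the arc bound would make the closing edge `< 1`
  by_contra hcon
  push Not at hcon
  have hk2 : 2 ≤ k + 1 := by omega
  have hδ0 : 0 ≤ ν / γ := div_nonneg hν hγ.le
  have hcast : ((k + 1 : ℕ) : ℝ) = (k : ℝ) + 1 := by push_cast; ring
  have hk1 : (1 : ℝ) ≤ (k : ℝ) + 1 := by
    have : (0 : ℝ) ≤ (k : ℝ) := Nat.cast_nonneg k
    linarith
  have hδ : ν / γ ≤ 1 / (240 * ((k + 1 : ℕ) : ℝ) ^ 3) := by
    rw [hcast, div_le_div_iff₀ hγ (by positivity), one_mul]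
    nlinarith [hcon]
  have hbound := harc (k + 1) B (ν / γ) hk2 hδ0 hδ hA1 hA2 hA3 0 k (by omega)
  rw [hlast, hcast] at hbound
  have h16 : 16 * ((k : ℝ) + 1) * (ν / γ) ≤ 1 := by
    rw [hcast] at hδ
    calc 16 * ((k : ℝ) + 1) * (ν / γ) ≤ 16 * ((k : ℝ) + 1) * (1 / (240 * ((k : ℝ) + 1) ^ 3)) := by
          gcongr
      _ = (1 / 15) * (1 / ((k : ℝ) + 1) ^ 2) := by field_simp; ring
      _ ≤ (1 / 15) * 1 := by
          gcongr
          rw [div_le_one (by positivity)]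
          nlinarith [hk1]
      _ ≤ 1 := by norm_num
  have hδ1 : ν / γ < 1 := by
    rw [hcast] at hδ
    refine lt_of_le_of_lt hδ ?_
    rw [div_lt_one (by positivity)]
    have hk3 : (1 : ℝ) ≤ ((k : ℝ) + 1) ^ 3 := one_le_pow₀ hk1
    linarith
  have hlt : (16 * ((k : ℝ) + 1)) ^ k * (ν / γ) ^ (k + 1) < 1 := by
    rw [pow_succ, ← mul_assoc, ← mul_pow]
    calc (16 * ((k : ℝ) + 1) * (ν / γ)) ^ k * (ν / γ) ≤ 1 ^ k * (ν / γ) := by gcongr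
      _ < 1 := by rw [one_pow, one_mul]; exact hδ1
  linarith

/-! ### The registered stub -/

/-- **Stub P6 (Theorem 4 from balancing and the arc bound).** If every cycle-product bound
`≤ M^{length}` (`M > 0`) can be balanced by a positive diagonal similarity (Lemma 1, hypothesis)
and every `n × n` matrix (`n ≥ 2`) with unit superdiagonal, entries of modulus `≤ 1` and interval
minors `≤ δ^{size}`, `δ ≤ 1/(240 n³)`, has backward entries `‖B (a+k) a‖ ≤ (16 n)^k δ^{k+1}`
(Lemma 2, hypothesis), then principal minors `≤ ν^{size}` force every cycle product of `K` to be
`≤ (240 R³ ν)^{length}`. [folklore] -/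
theorem stub_cycleBound :
    (∀ (R : ℕ) (K : Matrix (Fin R) (Fin R) ℂ) (M : ℝ), 0 < M →
      (∀ (n : ℕ) (v : Fin (n + 1) → Fin R), Function.Injective v →
        ‖∏ t : Fin (n + 1), K (v t) (v (t + 1))‖ ≤ M ^ (n + 1)) →
      ∃ d : Fin R → ℝ, (∀ i, 0 < d i) ∧ ∀ i j, d i * ‖K i j‖ / d j ≤ M) →
    (∀ (n : ℕ) (B : Matrix (Fin n) (Fin n) ℂ) (δ : ℝ), 2 ≤ n → 0 ≤ δ → δ ≤ 1 / (240 * (n : ℝ) ^ 3) →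
      (∀ (t : ℕ) (h : t + 1 < n), B ⟨t, by omega⟩ ⟨t + 1, h⟩ = 1) →
      (∀ i j : Fin n, ‖B i j‖ ≤ 1) →
      (∀ (a k : ℕ) (h : a + k < n),
        ‖(B.submatrix (fun i : Fin (k + 1) => (⟨a + i.val, by omega⟩ : Fin n))
          (fun i : Fin (k + 1) => (⟨a + i.val, by omega⟩ : Fin n))).det‖ ≤ δ ^ (k + 1)) →
      ∀ (a k : ℕ) (h : a + k < n), ‖B ⟨a + k, h⟩ ⟨a, by omega⟩‖ ≤ (16 * (n : ℝ)) ^ k * δ ^ (k + 1)) →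
    ∀ (R : ℕ) (K : Matrix (Fin R) (Fin R) ℂ) (ν : ℝ), 0 ≤ ν →
      (∀ (k : ℕ) (w : Fin (k + 1) → Fin R), Function.Injective w →
        ‖(K.submatrix w w).det‖ ≤ ν ^ (k + 1)) →
      ∀ (n : ℕ) (v : Fin (n + 1) → Fin R), Function.Injective v →
        ‖∏ t : Fin (n + 1), K (v t) (v (t + 1))‖ ≤ (240 * (R : ℝ) ^ 3 * ν) ^ (n + 1) := by
  intro hbal harc R K ν hν hmin n v hv
  classical
  have hnR : n + 1 ≤ R := by simpa using Fintype.card_le_of_injective v hv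
  -- the geometric means of all cycles, indexed by a finite type
  let g : (Σ k : Fin R, (Fin (k.val + 1) → Fin R)) → ℝ :=
    fun p => ‖∏ t, K (p.2 t) (p.2 (t + 1))‖ ^ (((p.1.val + 1 : ℕ) : ℝ)⁻¹)
  let S : Finset (Σ k : Fin R, (Fin (k.val + 1) → Fin R)) :=
    Finset.univ.filter (fun p => Function.Injective p.2)
  have hS : S.Nonempty := ⟨⟨⟨n, by omega⟩, v⟩, by simpa [S] using hv⟩
  obtain ⟨⟨⟨k, hk⟩, u⟩, hmem, hmax⟩ := Finset.exists_max_image S g hS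
  have hu : Function.Injective u := by simpa [S] using hmem
  -- `γ` is the maximal cycle geometric mean, attained at the cycle `u` of length `k + 1`
  set γ : ℝ := g ⟨⟨k, hk⟩, u⟩ with hγ_def
  have hγ0 : 0 ≤ γ := Real.rpow_nonneg (norm_nonneg _) _
  have hall : ∀ (m : ℕ) (w : Fin (m + 1) → Fin R), Function.Injective w →
      ‖∏ t, K (w t) (w (t + 1))‖ ≤ γ ^ (m + 1) := by
    intro m w hw
    have hmR : m + 1 ≤ R := by simpa using Fintype.card_le_of_injective w hw
    have hle : g ⟨⟨m, by omega⟩, w⟩ ≤ γ := hmax _ (by simpa [S] using hw)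
    have hg0 : 0 ≤ g ⟨⟨m, by omega⟩, w⟩ := Real.rpow_nonneg (norm_nonneg _) _
    calc ‖∏ t, K (w t) (w (t + 1))‖ = (g ⟨⟨m, by omega⟩, w⟩) ^ (m + 1) := by
          simp only [g]
          rw [Real.rpow_inv_natCast_pow (norm_nonneg _) (Nat.add_one_ne_zero m)]
      _ ≤ γ ^ (m + 1) := pow_le_pow_left₀ hg0 hle _
  have hP : γ ^ (k + 1) = ‖∏ t, K (u t) (u (t + 1))‖ := by
    simp only [hγ_def, g]
    rw [Real.rpow_inv_natCast_pow (norm_nonneg _) (Nat.add_one_ne_zero k)]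
  -- the main claim: `γ ≤ 240 R³ ν`
  have hmain : γ ≤ 240 * (R : ℝ) ^ 3 * ν := by
    rcases hγ0.eq_or_lt with hγz | hγpos
    · rw [← hγz]; positivity
    rcases Nat.eq_zero_or_pos k with hk0 | hkpos
    · -- the maximum is attained on a loop: `γ = ‖K i i‖ ≤ ν`
      subst hk0
      have h1 : ‖∏ t : Fin (0 + 1), K (u t) (u (t + 1))‖ = ‖K (u 0) (u 0)‖ := by
        rw [Fin.prod_univ_one]
        rfl
      have h2 := hmin 0 u hu
      rw [Matrix.det_fin_one, Matrix.submatrix_apply, pow_one] at h2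
      rw [pow_one, h1] at hP
      have hR1 : (1 : ℝ) ≤ 240 * (R : ℝ) ^ 3 := by
        have hR : (1 : ℝ) ≤ (R : ℝ) := by exact_mod_cast (show 1 ≤ R by omega)
        have hR3 : (1 : ℝ) ≤ (R : ℝ) ^ 3 := one_le_pow₀ hR
        linarith
      calc γ ≤ ν := hP ▸ h2
        _ = 1 * ν := (one_mul ν).symm
        _ ≤ 240 * (R : ℝ) ^ 3 * ν := mul_le_mul_of_nonneg_right hR1 hν
    · obtain ⟨d, hd, hdK⟩ := hbal R K γ hγpos hall
      have h := core_cycle harc K hν hγpos hmin d hd hdK hkpos u hu hP.le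
      have hkR : (k : ℝ) + 1 ≤ (R : ℝ) := by
        have : k + 1 ≤ R := by simpa using Fintype.card_le_of_injective u hu
        exact_mod_cast this
      calc γ ≤ 240 * ((k : ℝ) + 1) ^ 3 * ν := h
        _ ≤ 240 * (R : ℝ) ^ 3 * ν := by gcongr
  calc ‖∏ t, K (v t) (v (t + 1))‖ ≤ γ ^ (n + 1) := hall n v hv
    _ ≤ (240 * (R : ℝ) ^ 3 * ν) ^ (n + 1) := pow_le_pow_left₀ hγ0 hmain _

end Summit.ValiantsHypothesis.ValiantsHypothesis.Theorems.PriceOfContractivity.CycleBound
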